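import Summits.BirchSwinnertonDyer.BirchSwinnertonDyer.Theorems.AdditiveKolyvaginRoadVisibleCoreBricks
import Summits.BirchSwinnertonDyer.BirchSwinnertonDyer.Theorems.AdditiveKolyvaginRoadKolyvaginVisibilityStep
import HarnessLib

/-!
# Route `AdditiveKolyvaginRoad`, crux `LevelKolyvaginSystemsAdditive` (item stmt-BirchSwinnertonDyer-21396, KS′) ∕ KPA′ (21400):
# THE CLOSURE COUNT AT A 𝔭-VISIBLE CORE VERTEX — the residual Selmer group `Sel_{∅,0}(K, E[p])_{n₀}` (relaxed at `𝔭`, strict at `𝔭'`,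
# level `n₀` elsewhere) is TRIVIAL (step (5) of the crux-ideate card `Cruxes/LevelKolyvaginSystemsAdditive/Ideas/pointwise-klingen-seed.md`,
# E-side, in the route's canonical spaces; companion of `…VisibleEvenCoreLevel.lean` = S-vis)
# (cell `pub/bsd-wall`, width seat `bsd-wall-akr-p2x-w2` g9; `--supports stmt-BirchSwinnertonDyer-21396`, helper)

WHY. The card closes its single-weight Klingen–Eisenstein contrapositive by «a verified Poitou–Tate count» at a 𝔭-VISIBLE even core vertex
`n₀`: `Sel_{∅,0}(K, E[p])_{n₀} = 0` (at an INVISIBLE core vertex `dim Sel_{∅,0} ∈ {1, 2}` and nothing can be contradicted). S-vis (the vertex)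
is the tree theorem `exists_visibleEvenCoreLevel`; THIS FILE is the count, by ONE Tate reciprocity, symmetric in `𝔭 ↔ 𝔭'`.

WHAT (namespace `…Theorems.AdditiveKoly`).
* §1 `mem_selmerLocalKer_of_cupProduct_eq_zero_of_kummerLine` — at ANY finite `v` where E's Kummer condition `F_v` has `p` elements (`K`
  imaginary quadratic): `r` Kummer at `v`, `loc_v r ≠ 0`, `loc_v r ∪ₑ loc_v y = 0` ⟹ `y` Kummer at `v` (`F_v = ℤ·loc_v r` is its own
  annihilator: `annRight_kummer_eq_P` for a perfect family from the PROVED `poitouTate_sum_localTatePairing_eq_zero_of_isTotallyComplex`);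
  `natCard_kummer_eq_of_natCard_localH1_eq_sq` — `#H¹(K_v, E[p]) = p²` ⟹ `#F_v = p` (the hypothesis shape of w4 g4's `bdpSwitchAtBottom`).
* §2 `residualSelmer_eq_zero_at_visibleCore` — **`Sel_{rel 𝔭, str 𝔭'}(level n₀) = 0` AT A 𝔭-VISIBLE CORE VERTEX** (`K` imaginary quadratic,
  `p` odd, `c ≠ 1`; `n₀` with `dim Sel_{n₀}⁺ + dim Sel_{n₀}⁻ = 1` and non-zero classes visible above `p`; `𝔭 ≠ 𝔭'` above `p`, `#F_𝔭 = p`):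
  every class Kummer at `∞` and off `n₀ ∪ {v ∣ p}`, toric on `n₀`, locally TRIVIAL at `𝔭'`, free at `𝔭`, is ZERO. Proof: reciprocity for
  `(s, x)`, `s` spanning the core line, kills the `𝔭`-term (Kummer ∕ toric isotropy elsewhere, `loc_{𝔭'} x = 0`) ⟹ `x` Kummer at `𝔭` (§1;
  `loc_𝔭 s` spans `F_𝔭` by visibility); `{v ∣ p} = {𝔭, 𝔭'}` (`Aut(K/ℚ) = {1,c}` transitive) ⟹ `x` satisfies the whole level structure;
  eigen-splitting (`conjAct_mem_relaxedAt`) puts `2x` in the core line, where non-zero classes are visible at `𝔭'` ⟹ `2x = 0 = x`.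
  Composes with `exists_visibleEvenCoreLevel` (whose conclusion is exactly the `htot`/`hvis` input here). ALL UNCONDITIONAL (axioms standard).

HONEST FRAMING: theorems only; 0 definitions, 0 named facts, 0 `sorry`. E-side closure of the card's chain only; the automorphic links
(FPK(n₀), the U(3,1) congruence, (E1)_{n₀}) are untouched. `#F_𝔭 = p` is where the card's binder `E(ℚ_p)[p] = 0` enters
(`#F_𝔭 = #E(K_𝔭)[p]·#(𝓞_𝔭 ⧸ p)`, `p` split; on the `LocIrr` locus it is akr-p2x-w4 g5's `SplitPlane.natCard_localH1_eq_sq_of_locIrr_of_heegner`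
+ `natCard_kummer_eq_of_natCard_localH1_eq_sq`). BSD is not proved by any of this; KS′ ∕ KPA′ stay OPEN at `p² ∣ N`.

References: [cite: MazurRubin2004, Lemma 4.1.7, Prop. 4.5.8] [cite: JetchevSkinnerWan2017, (3.5.d), Prop. 3.3.2] [cite: MilneADT2006, Ch. I,
Cor. 2.3, Thm. 2.8, Thm. 4.10] [cite: WZhang2014, Lemma 5.3, Prop. 5.4] [cite: BertoliniDarmon2005, §2.2–§2.3] [cite: PoonenRains2012, Prop. 4.10]
[cite: CasselsFrohlichANT1967, Ch. VII Prop. 1.2 (ii), §11].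
-/

set_option linter.dupNamespace false -- single-conjunct summit repeats the name by design

noncomputable section

open scoped Classical NumberField Pointwise

namespace Summit.BirchSwinnertonDyer.BirchSwinnertonDyer.Theorems.AdditiveKoly

open CategoryTheory WeierstrassCurve Field Function NumberField IsDedekindDomain
open Literature.NumberTheory.EllipticCurves Literature.NumberTheory.EllipticCurves.ModularForms
  Literature.NumberTheory.GaloisRepresentations Literature.NumberTheory.GaloisRepresentations.DiscreteGaloisModule
  Literature.NumberTheory.GaloisCohomology Module
open Summit.BirchSwinnertonDyer.Rank1Residual.X11b.FiniteDuality
open Summit.BirchSwinnertonDyer.Rank1Residual.X11b.Relaxation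
open Summit.BirchSwinnertonDyer.Rank1Residual.X11b
open Summit.BirchSwinnertonDyer.Rank1Residual.GaloisImage
open Summit.BirchSwinnertonDyer.Rank1Residual.X11b.Three.Koly
open Summit.BirchSwinnertonDyer.Rank1Residual.X11b.Three.Koly.Method2
open Summit.BirchSwinnertonDyer.Rank1Residual.X11b.Three.Koly.ZhangSupply.LocalConj
open scoped ContRepresentation

/-! ## §1 A Kummer line of prime order is detected by one pairing -/

section KummerLine

variable (W : WeierstrassCurve ℚ) (K : Type) [Field K] [NumberField K] (p : ℕ) [W.IsElliptic]
  [Fact p.Prime] [IsTotallyComplex K] [∀ v : Place K, CompactSpace (absoluteGaloisGroup (Place.Completion v))]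
variable (e : geomTorsion (W.baseChange K) ((p ^ 1 : ℕ) : ℤ) → geomTorsion (W.baseChange K) ((p ^ 1 : ℕ) : ℤ) →
    AlgebraicClosure K)
  (hμ : ∀ S T, e S T ^ (p ^ 1) = 1)
  (hadd₁ : ∀ S₁ S₂ T, e (S₁ + S₂) T = e S₁ T * e S₂ T)
  (hadd₂ : ∀ S T₁ T₂, e S (T₁ + T₂) = e S T₁ * e S T₂) (halt : ∀ Q, e Q Q = 1)
  (hnondeg : ∀ Q, (∀ P, e P Q = 1) → Q = 0)
  (hgal : ∀ (σ : absoluteGaloisGroup K) (S T : geomTorsion (W.baseChange K) ((p ^ 1 : ℕ) : ℤ)),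
    σ • e S T = e (σ • S) (σ • T))

include halt hnondeg in
/-- **A Kummer LINE is detected by one cup product.** `K` imaginary quadratic, `v` any finite place at which E's Kummer condition
`F_v ≤ H¹(K_v, E[p])` has exactly `p` elements: if `r` is Kummer at `v` with `loc_v r ≠ 0` and `loc_v r ∪ₑ loc_v y = 0`, then `y` is
Kummer at `v` (`F_v = ℤ · loc_v r` is its own annihilator for `inv_v(· ∪ₑ ·)` — `annRight_kummer_eq_P` for a perfect Poitou–Tate family,
which exists by the PROVED `poitouTate_sum_localTatePairing_eq_zero_of_isTotallyComplex`). The place-agnostic form of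
`cupProduct_ne_zero_of_kummer_of_not_kummer_admQ`. [cite: MilneADT2006, Ch. I, Cor. 2.3] [cite: PoonenRains2012, Prop. 4.10] -/
theorem mem_selmerLocalKer_of_cupProduct_eq_zero_of_kummerLine (hK : IsImaginaryQuadratic K) (v : HeightOneSpectrum (𝓞 K))
    (hline : Nat.card ((W.baseChange K).kummerSelmerStructure ((p ^ 1 : ℕ) : ℤ) (Sum.inr v)) = p) {r y : Vp W K p}
    (hr : r ∈ selmerLocalKer (W.baseChange K) (v.adicCompletion K) ((p ^ 1 : ℕ) : ℤ))
    (hr0 : r ∉ (W.baseChange K).torsionLocalKer (v.adicCompletion K) ((p ^ 1 : ℕ) : ℤ))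
    (h0 : (weilContPairingLocal (W.baseChange K) (p ^ 1) e hμ hadd₁ hadd₂ hgal (Sum.inr v)).cupProduct
        (galoisCohomology.localization ((W.baseChange K).torsionGaloisModule ((p ^ 1 : ℕ) : ℤ)) (Sum.inr v) 1 r)
        (galoisCohomology.localization ((W.baseChange K).torsionGaloisModule ((p ^ 1 : ℕ) : ℤ)) (Sum.inr v) 1 y) = 0) :
    y ∈ selmerLocalKer (W.baseChange K) (v.adicCompletion K) ((p ^ 1 : ℕ) : ℤ) := by
  have hp : p.Prime := Fact.out
  haveI : NeZero (p ^ 1 : ℕ) := ⟨pow_ne_zero 1 hp.ne_zero⟩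
  obtain ⟨inv, hperf, -⟩ := poitouTate_sum_localTatePairing_eq_zero_of_isTotallyComplex K (p ^ 1)
  set loc := galoisCohomology.localization ((W.baseChange K).torsionGaloisModule ((p ^ 1 : ℕ) : ℤ)) (Sum.inr v) 1
    with hloc
  set F := (W.baseChange K).kummerSelmerStructure ((p ^ 1 : ℕ) : ℤ) (Sum.inr v) with hF
  set b := invWeilPairing (W.baseChange K) (p ^ 1) e hμ hadd₁ hadd₂ hgal inv (Sum.inr v) with hb
  have hrF : loc r ∈ F := by
    rw [hF, WeierstrassCurve.kummerSelmerStructure_apply]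
    exact (mem_selmerLocalKer_iff_localization_mem_kummer_P W K p v r).mp hr
  have hr0' : loc r ≠ 0 := fun h ↦ hr0 ((mem_torsionLocalKer_iff_localization_eq_zero_P W K p v r).mpr h)
  -- `F` has `p` elements, hence is generated by `loc r`
  have hgen : ∀ l ∈ F, ∃ k : ℤ, k • loc r = l := by
    intro l hl
    have hne : (⟨loc r, hrF⟩ : F) ≠ 0 := fun h ↦ hr0' (by
      have := congrArg Subtype.val h
      exact this)
    have htop := zmultiples_eq_top_of_prime_card (p := p) hline hne
    have hmem : (⟨l, hl⟩ : F) ∈ AddSubgroup.zmultiples (⟨loc r, hrF⟩ : F) := by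
      rw [htop]; exact AddSubgroup.mem_top _
    obtain ⟨k, hk⟩ := AddSubgroup.mem_zmultiples_iff.mp hmem
    exact ⟨k, by
      have := congrArg Subtype.val hk
      simpa only [AddSubgroupClass.coe_zsmul] using this⟩
  have hann := annRight_kummer_eq_P W K p e hμ hadd₁ hadd₂ halt hnondeg hgal inv hK hperf (Sum.inr v)
  have hb0 : b (loc r) (loc y) = 0 := by
    rw [hb, invWeilPairing_apply, h0]
    exact map_zero _
  have hyann : loc y ∈ annRight b F := by
    rw [mem_annRight_iff]
    intro l hl
    obtain ⟨k, rfl⟩ := hgen l hl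
    rw [map_zsmul, AddMonoidHom.zsmul_apply, hb0, smul_zero]
  rw [hb, hF, hann] at hyann
  rw [WeierstrassCurve.kummerSelmerStructure_apply] at hyann
  exact (mem_selmerLocalKer_iff_localization_mem_kummer_P W K p v y).mpr hyann

end KummerLine

section KummerCount

variable (W : WeierstrassCurve ℚ) (K : Type) [Field K] [NumberField K] (p : ℕ) [W.IsElliptic] [Fact p.Prime]

/-- **`#F_v = p` from `#H¹(K_v, E[p]) = p²`** (`K` imaginary quadratic, any finite `v`): the Kummer condition is Lagrangian for
`inv_v(· ∪ₑ ·)` (`annRight_kummer_eq_P`), so `#F_v · #F_v = #H¹(K_v, E[p])` (`natCard_mul_self_eq_of_annRight_eq`); a Weil pairing and a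
perfect family exist by the PROVED `exists_weilPairing_holds` ∕ `poitouTate_sum_localTatePairing_eq_zero_of_isTotallyComplex`. The hypothesis
shape of akr-p2x-w4 g4's `bdpSwitchAtBottom` («a PLANE at `𝔭`») thus gives the `hline` input of §2. [cite: MilneADT2006, Ch. I, Cor. 2.3] -/
theorem natCard_kummer_eq_of_natCard_localH1_eq_sq (hK : IsImaginaryQuadratic K) (v : HeightOneSpectrum (𝓞 K))
    (hsq : Nat.card (galoisCohomology (((W.baseChange K).torsionGaloisModule ((p ^ 1 : ℕ) : ℤ)).toLocal (Sum.inr v)) 1) = p ^ 2) :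
    Nat.card ((W.baseChange K).kummerSelmerStructure ((p ^ 1 : ℕ) : ℤ) (Sum.inr v)) = p := by
  have hp : p.Prime := Fact.out
  haveI : NeZero (p ^ 1 : ℕ) := ⟨pow_ne_zero 1 hp.ne_zero⟩
  haveI : IsTotallyComplex K := hK.2
  haveI : Finite (geomTorsion (W.baseChange K) ((p ^ 1 : ℕ) : ℤ)) := finite_geomTorsion_of_neZero (W.baseChange K) (p ^ 1)
  obtain ⟨e, hμ, hadd₁, hadd₂, halt, hnondeg, hgal⟩ :=
    exists_weilPairing_holds (W.baseChange K) (p ^ 1) (by rw [pow_one]; exact hp.two_le) (by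
      exact_mod_cast pow_ne_zero 1 hp.ne_zero)
  obtain ⟨inv, hperf, -⟩ := poitouTate_sum_localTatePairing_eq_zero_of_isTotallyComplex K (p ^ 1)
  have h := natCard_mul_self_eq_of_annRight_eq W K p e hμ hadd₁ hadd₂ hnondeg hgal inv v (hperf v).1.1 _
    (annRight_kummer_eq_P W K p e hμ hadd₁ hadd₂ halt hnondeg hgal inv hK hperf (Sum.inr v))
  rw [hsq, sq] at h
  exact Nat.mul_self_inj.mp h

end KummerCount

/-! ## §2 The residual Selmer group at a 𝔭-visible core vertex is trivial -/

section Residual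

variable (W : WeierstrassCurve ℚ) (K : Type) [Field K] [NumberField K] (p : ℕ) [W.IsElliptic] [W.IsGloballyMinimal]
  [Fact p.Prime]

set_option maxHeartbeats 800000 in
/-- **THE CLOSURE COUNT: `Sel_{∅,0}(K, E[p])_{n₀} = 0` AT A 𝔭-VISIBLE CORE VERTEX** (step (5) of card `pointwise-klingen-seed`, E-side).
`K` imaginary quadratic, `p` odd, `c ≠ 1`, the `ZMod p`-structure of `H¹(K, E[p])`; `n₀` a finite set of BD-admissible primes which is a
CORE vertex (`dim Sel_{n₀}⁺ + dim Sel_{n₀}⁻ = 1`) and 𝔭-VISIBLE (non-zero classes of `Sel_{n₀}^±` not locally trivial above `p` — the output of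
`exists_visibleEvenCoreLevel`); `𝔭 ≠ 𝔭'` above `p` with `#F_𝔭 = p`. THEN every `x ∈ H¹(K, E[p])` Kummer at `∞` and at the finite places off
`n₀ ∪ {v ∣ p}`, toric above the primes of `n₀`, locally TRIVIAL at `𝔭'` and UNCONSTRAINED at `𝔭` is ZERO (the residual group
`Sel_{rel 𝔭, str 𝔭'}` of the level-`n₀` structure — Castella's ∕ JSW's `Sel_{∅,0}` at level `n₀`, mod `p` — vanishes). Proof in the module
docstring. UNCONDITIONAL. [cite: MazurRubin2004, Lemma 4.1.7 (b)] [cite: JetchevSkinnerWan2017, (3.5.d)] [cite: MilneADT2006, Ch. I, Thm. 4.10]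
[cite: WZhang2014, Lemma 5.3] -/
theorem residualSelmer_eq_zero_at_visibleCore (hK : IsImaginaryQuadratic K) (hp2 : p ≠ 2) {c : K ≃ₐ[ℚ] K} (hc1 : c ≠ 1)
    [Module (ZMod p) (Vp W K p)] (n₀ : Finset (AdmQ W K p))
    (htot : finrank (ZMod p) (SelQP W K p c n₀ true) + finrank (ZMod p) (SelQP W K p c n₀ false) = 1)
    (hvis : ∀ (μ : Bool) (x : Vp W K p), x ∈ SelQP W K p c n₀ μ → x ≠ 0 →
      ∀ v : HeightOneSpectrum (𝓞 K), ((p : ℕ) : 𝓞 K) ∈ v.asIdeal →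
        x ∉ (W.baseChange K).torsionLocalKer (v.adicCompletion K) ((p ^ 1 : ℕ) : ℤ))
    (𝔭 𝔭' : HeightOneSpectrum (𝓞 K)) (h𝔭 : ((p : ℕ) : 𝓞 K) ∈ 𝔭.asIdeal) (h𝔭' : ((p : ℕ) : 𝓞 K) ∈ 𝔭'.asIdeal) (hne : 𝔭 ≠ 𝔭')
    (hline : Nat.card ((W.baseChange K).kummerSelmerStructure ((p ^ 1 : ℕ) : ℤ) (Sum.inr 𝔭)) = p)
    {x : Vp W K p}
    (hxinf : ∀ u : InfinitePlace K, x ∈ selmerLocalKer (W.baseChange K) u.Completion ((p ^ 1 : ℕ) : ℤ))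
    (hxfin : ∀ v : HeightOneSpectrum (𝓞 K), ((p : ℕ) : 𝓞 K) ∉ v.asIdeal →
      ((∀ q ∈ n₀, ((q : ℕ) : 𝓞 K) ∉ v.asIdeal) →
        x ∈ selmerLocalKer (W.baseChange K) (v.adicCompletion K) ((p ^ 1 : ℕ) : ℤ)) ∧
      (∀ q ∈ n₀, ((q : ℕ) : 𝓞 K) ∈ v.asIdeal →
        x ∈ toricLocalKer (W.baseChange K) (v.adicCompletion K) ((p ^ 1 : ℕ) : ℤ)))
    (hx𝔭' : x ∈ (W.baseChange K).torsionLocalKer (𝔭'.adicCompletion K) ((p ^ 1 : ℕ) : ℤ)) :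
    x = 0 := by
  classical
  have hp : p.Prime := Fact.out
  haveI : Fact (Nat.Prime (p ^ 1)) := ⟨by rw [pow_one]; exact hp⟩
  haveI : NeZero (p ^ 1 : ℕ) := ⟨pow_ne_zero 1 hp.ne_zero⟩
  haveI : IsTotallyComplex K := hK.2
  haveI : Algebra.IsQuadraticExtension ℚ K := ⟨hK.1⟩
  haveI : ∀ w : Place K, CompactSpace (absoluteGaloisGroup (Place.Completion w)) := fun w ↦
    absoluteGaloisGroup_compactSpace _
  haveI hcs : ∀ (L : Type) [Field L], CompactSpace (absoluteGaloisGroup L) :=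
    fun L _ ↦ @absoluteGaloisGroup_compactSpace L _
  haveI : Finite (geomTorsion (W.baseChange K) ((p ^ 1 : ℕ) : ℤ)) :=
    finite_geomTorsion_of_neZero (W.baseChange K) (p ^ 1)
  have hpZ : ((p ^ 1 : ℕ) : ℤ) ≠ 0 := by exact_mod_cast pow_ne_zero 1 hp.ne_zero
  have hNodd : Odd (((p ^ 1 : ℕ) : ℤ)) := by
    rw [pow_one]
    exact_mod_cast hp.odd_of_ne_two hp2
  have hK2 : Module.finrank ℚ K = 2 := hK.1
  have hcc : c * c = 1 := algEquiv_mul_self_eq_one K hK c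
  set τ := conjAct W c ((p ^ 1 : ℕ) : ℤ) with hτ
  have hττ : ∀ y : Vp W K p, τ (τ y) = y := fun y ↦ conjAct_conjAct_of_mul_self W hcc ((p ^ 1 : ℕ) : ℤ) y
  obtain ⟨e, hμ, hadd₁, hadd₂, halt, hnondeg, hgal⟩ :=
    exists_weilPairing_holds (W.baseChange K) (p ^ 1) (by rw [pow_one]; exact hp.two_le) (by
      rw [pow_one]; exact_mod_cast hp.ne_zero)
  -- the places above `p` are `𝔭` and `𝔭'`
  have hall : ∀ v : HeightOneSpectrum (𝓞 K), ((p : ℕ) : 𝓞 K) ∈ v.asIdeal → v = 𝔭 ∨ v = 𝔭' := by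
    intro v hv
    obtain ⟨σ, hσ⟩ := Literature.NumberTheory.Automorphic.HeightOneSpectrum.exists_algEquiv_smul_eq ℚ
      (under_eq_under_of_natCast_mem hp h𝔭 hv)
    obtain ⟨σ', hσ'⟩ := Literature.NumberTheory.Automorphic.HeightOneSpectrum.exists_algEquiv_smul_eq ℚ
      (under_eq_under_of_natCast_mem hp h𝔭 h𝔭')
    rcases algEquiv_eq_one_or_eq_of_finrank_two hK2 hc1 σ with rfl | rfl
    · left; rw [one_smul] at hσ; exact hσ.symm
    · rcases algEquiv_eq_one_or_eq_of_finrank_two hK2 hc1 σ' with rfl | rfl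
      · rw [one_smul] at hσ'; exact absurd hσ' hne
      · right; rw [← hσ, hσ']
  -- admissible primes lie under no place above `p`
  have hadm_p : ∀ (q : AdmQ W K p) (v : HeightOneSpectrum (𝓞 K)), ((p : ℕ) : 𝓞 K) ∈ v.asIdeal →
      ((q : ℕ) : 𝓞 K) ∉ v.asIdeal := fun q v hpv hqv ↦ by
    have h := (hasGoodReductionAt_of_isAdmissiblePrime W K q.2 v hqv).2
    rw [Int.cast_natCast] at h
    exact h hpv
  -- unpacking membership in a canonical space
  have hmem : ∀ (μ : Bool) (y : Vp W K p), y ∈ SelQP W K p c n₀ μ →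
      (∀ w : InfinitePlace K, y ∈ selmerLocalKer (W.baseChange K) w.Completion ((p ^ 1 : ℕ) : ℤ)) ∧
      (∀ w : HeightOneSpectrum (𝓞 K), (∀ q' ∈ n₀, ((q' : ℕ) : 𝓞 K) ∉ w.asIdeal) →
        y ∈ selmerLocalKer (W.baseChange K) (w.adicCompletion K) ((p ^ 1 : ℕ) : ℤ)) ∧
      (∀ q' ∈ n₀, ∀ w : HeightOneSpectrum (𝓞 K), ((q' : ℕ) : 𝓞 K) ∈ w.asIdeal →
        y ∈ toricLocalKer (W.baseChange K) (w.adicCompletion K) ((p ^ 1 : ℕ) : ℤ)) := by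
    intro μ y hy
    have hy' : y ∈ levelSelmerSubgroupP W K p c (n₀.image Subtype.val) ∅ μ := hy
    simp only [levelSelmerSubgroupP, AddSubgroup.mem_inf, AddSubgroup.mem_iInf] at hy'
    obtain ⟨-, hinf, hfin, hord⟩ := hy'
    refine ⟨hinf, fun w hw ↦ hfin w fun q'' hq'' ↦ ?_, fun q' hq' w hw ↦ hord q' ⟨?_, Set.notMem_empty _⟩ w hw⟩
    · rcases hq'' with hq'' | hq''
      · rw [Finset.mem_coe, Finset.mem_image] at hq''
        obtain ⟨a, ha, rfl⟩ := hq''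
        exact hw a ha
      · exact absurd hq'' (Set.notMem_empty _)
    · exact Finset.mem_image.mpr ⟨q', hq', rfl⟩
  -- packing membership in a canonical space
  have hpack : ∀ (μ : Bool) (y : Vp W K p), τ y = sgnP μ • y →
      (∀ w : InfinitePlace K, y ∈ selmerLocalKer (W.baseChange K) w.Completion ((p ^ 1 : ℕ) : ℤ)) →
      (∀ w : HeightOneSpectrum (𝓞 K), (∀ q' ∈ n₀, ((q' : ℕ) : 𝓞 K) ∉ w.asIdeal) →
        y ∈ selmerLocalKer (W.baseChange K) (w.adicCompletion K) ((p ^ 1 : ℕ) : ℤ)) →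
      (∀ q' ∈ n₀, ∀ w : HeightOneSpectrum (𝓞 K), ((q' : ℕ) : 𝓞 K) ∈ w.asIdeal →
        y ∈ toricLocalKer (W.baseChange K) (w.adicCompletion K) ((p ^ 1 : ℕ) : ℤ)) →
      y ∈ SelQP W K p c n₀ μ := by
    intro μ y hyτ hinf hfin hord
    change y ∈ levelSelmerSubgroupP W K p c (n₀.image Subtype.val) ∅ μ
    simp only [levelSelmerSubgroupP, AddSubgroup.mem_inf, AddSubgroup.mem_iInf]
    refine ⟨?_, hinf, fun w hw ↦ hfin w fun q' hq' ↦ hw q' (Or.inl ?_), fun q' hq' w hw ↦ ?_⟩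
    · rw [AddMonoidHom.mem_ker, AddMonoidHom.sub_apply, sub_eq_zero]
      exact hyτ
    · exact Finset.mem_coe.mpr (Finset.mem_image_of_mem _ hq')
    · obtain ⟨hq'n, -⟩ := hq'
      obtain ⟨a, ha, rfl⟩ := Finset.mem_image.mp hq'n
      exact hord a ha w hw
  -- the core line `L = Sel_{n₀}^μ` and its complement `Sel_{n₀}^{¬μ} = 0`
  obtain ⟨μ, hμ1, hμ0⟩ : ∃ μ : Bool, finrank (ZMod p) (SelQP W K p c n₀ μ) = 1 ∧ SelQP W K p c n₀ (!μ) = ⊥ := by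
    haveI := finiteDimensional_selQP W K p c n₀ true
    haveI := finiteDimensional_selQP W K p c n₀ false
    by_cases h : finrank (ZMod p) (SelQP W K p c n₀ true) = 1
    · refine ⟨true, h, ?_⟩
      have h0 : finrank (ZMod p) (SelQP W K p c n₀ false) = 0 := by omega
      show SelQP W K p c n₀ false = ⊥
      exact Submodule.finrank_eq_zero.mp h0
    · refine ⟨false, by omega, ?_⟩
      have h0 : finrank (ZMod p) (SelQP W K p c n₀ true) = 0 := by omega
      show SelQP W K p c n₀ true = ⊥
      exact Submodule.finrank_eq_zero.mp h0
  haveI := finiteDimensional_selQP W K p c n₀ μ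
  -- a generator `s` of the core line
  obtain ⟨s, hs, hs0⟩ : ∃ s ∈ SelQP W K p c n₀ μ, s ≠ 0 := by
    by_contra hall'
    push Not at hall'
    have : SelQP W K p c n₀ μ = ⊥ := (Submodule.eq_bot_iff _).mpr hall'
    rw [this, finrank_bot] at hμ1
    exact zero_ne_one hμ1
  obtain ⟨hsinf, hsfin, hsord⟩ := hmem μ s hs
  -- `s` is Kummer at `𝔭` and VISIBLE there
  have hs𝔭K : s ∈ selmerLocalKer (W.baseChange K) (𝔭.adicCompletion K) ((p ^ 1 : ℕ) : ℤ) :=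
    hsfin 𝔭 fun q' _ ↦ hadm_p q' 𝔭 h𝔭
  have hs𝔭 : s ∉ (W.baseChange K).torsionLocalKer (𝔭.adicCompletion K) ((p ^ 1 : ℕ) : ℤ) := hvis μ s hs hs0 𝔭 h𝔭
  -- Kummer isotropy where both classes are Kummer
  have hKum : ∀ w : Place K,
      s ∈ selmerLocalKer (W.baseChange K) (Place.Completion w) ((p ^ 1 : ℕ) : ℤ) →
      x ∈ selmerLocalKer (W.baseChange K) (Place.Completion w) ((p ^ 1 : ℕ) : ℤ) →
      (weilContPairingLocal (W.baseChange K) (p ^ 1) e hμ hadd₁ hadd₂ hgal w).cupProduct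
        (galoisCohomology.localization ((W.baseChange K).torsionGaloisModule ((p ^ 1 : ℕ) : ℤ)) w 1 s)
        (galoisCohomology.localization ((W.baseChange K).torsionGaloisModule ((p ^ 1 : ℕ) : ℤ)) w 1 x) = 0 := by
    intro w hsw hxw
    rw [← comap_localization_kummerSelmerStructure] at hsw hxw
    exact (W.baseChange K).cupProduct_eq_zero_of_mem_kummerSelmerStructure_of_fact (p ^ 1) e hpZ w
      (kummerClass_cupProduct_kummerClass_eq_zero_holds _) hμ hadd₁ hadd₂ halt hgal hsw hxw
  -- the local terms of `(s, x)` vanish off `S = {𝔭, 𝔭'}` …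
  set S : Finset (Place K) := {Sum.inr 𝔭, Sum.inr 𝔭'} with hSdef
  have hS : ∀ w : Place K, w ∉ S →
      (weilContPairingLocal (W.baseChange K) (p ^ 1) e hμ hadd₁ hadd₂ hgal w).cupProduct
        (galoisCohomology.localization ((W.baseChange K).torsionGaloisModule ((p ^ 1 : ℕ) : ℤ)) w 1 s)
        (galoisCohomology.localization ((W.baseChange K).torsionGaloisModule ((p ^ 1 : ℕ) : ℤ)) w 1 x) = 0 := by
    intro w hw
    rcases w with w | w
    · exact hKum (Sum.inl w) (hsinf w) (hxinf w)
    · have hwp : ((p : ℕ) : 𝓞 K) ∉ w.asIdeal := fun h ↦ by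
        rcases hall w h with rfl | rfl
        · exact hw (by rw [hSdef]; exact Finset.mem_insert_self _ _)
        · exact hw (by rw [hSdef]; exact Finset.mem_insert_of_mem (Finset.mem_singleton_self _))
      by_cases hex : ∃ q' ∈ n₀, ((q' : ℕ) : 𝓞 K) ∈ w.asIdeal
      · obtain ⟨q', hq'n, hq'w⟩ := hex
        exact weilCupProduct_res_eq_zero_of_valued (W.baseChange K) (p ^ 1) (w.adicCompletion K)
          e hμ hadd₁ hadd₂ hgal _
          (fun S' hS' T hT ↦ weilPairingHom_eq_zero_of_mem_of_card_le (W.baseChange K) (p ^ 1)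
            e hμ hadd₁ hadd₂ halt _ (natCard_augmentation_le_of_admQ W K p hK.1 q' w hq'w) S' T hS' hT)
          (exists_valued_cocycle_of_mem_toricLocalKer (W.baseChange K) (p ^ 1) (w.adicCompletion K)
            (hsord q' hq'n w hq'w))
          (exists_valued_cocycle_of_mem_toricLocalKer (W.baseChange K) (p ^ 1) (w.adicCompletion K)
            ((hxfin w hwp).2 q' hq'n hq'w))
      · push Not at hex
        exact hKum (Sum.inr w) (hsfin w hex) ((hxfin w hwp).1 hex)
  -- … and at `𝔭'` (`loc_{𝔭'} x = 0`), so by Tate reciprocity the `𝔭`-term vanishes too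
  have h𝔭0 : (weilContPairingLocal (W.baseChange K) (p ^ 1) e hμ hadd₁ hadd₂ hgal (Sum.inr 𝔭)).cupProduct
      (galoisCohomology.localization ((W.baseChange K).torsionGaloisModule ((p ^ 1 : ℕ) : ℤ)) (Sum.inr 𝔭) 1 s)
      (galoisCohomology.localization ((W.baseChange K).torsionGaloisModule ((p ^ 1 : ℕ) : ℤ)) (Sum.inr 𝔭) 1 x) = 0 := by
    by_contra hne0
    obtain ⟨w, hwS, hwne, hw0⟩ := exists_cupProduct_ne_zero_of_ne (W.baseChange K) (p ^ 1) e hμ hadd₁ hadd₂ hgal S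
      (by rw [hSdef]; exact Finset.mem_insert_self _ _) hS hne0
    rw [hSdef, Finset.mem_insert, Finset.mem_singleton] at hwS
    rcases hwS with hwS | rfl
    · exact hwne hwS
    · apply hw0
      rw [(mem_torsionLocalKer_iff_localization_eq_zero_P W K p 𝔭' x).mp hx𝔭']
      exact map_zero _
  -- hence `x` is Kummer at `𝔭` (the Kummer line at `𝔭` is spanned by the visible `loc_𝔭 s`)
  have hx𝔭K : x ∈ selmerLocalKer (W.baseChange K) (𝔭.adicCompletion K) ((p ^ 1 : ℕ) : ℤ) :=
    mem_selmerLocalKer_of_cupProduct_eq_zero_of_kummerLine W K p e hμ hadd₁ hadd₂ halt hnondeg hgal hK 𝔭 hline hs𝔭K hs𝔭 h𝔭0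
  -- so `x` satisfies the whole level-`n₀` structure; so do `x ± τ x`
  have hx𝔭'K : x ∈ selmerLocalKer (W.baseChange K) (𝔭'.adicCompletion K) ((p ^ 1 : ℕ) : ℤ) :=
    (W.baseChange K).torsionLocalKer_le_selmerLocalKer (𝔭'.adicCompletion K) _ hx𝔭'
  have hxall : (∀ w : InfinitePlace K, x ∈ selmerLocalKer (W.baseChange K) w.Completion ((p ^ 1 : ℕ) : ℤ)) ∧
      (∀ v' : HeightOneSpectrum (𝓞 K), ((1 : ℕ) : 𝓞 K) ∉ v'.asIdeal →
        ((∀ q' ∈ n₀, ((q' : ℕ) : 𝓞 K) ∉ v'.asIdeal) →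
          x ∈ selmerLocalKer (W.baseChange K) (v'.adicCompletion K) ((p ^ 1 : ℕ) : ℤ)) ∧
        (∀ q' ∈ n₀, ((q' : ℕ) : 𝓞 K) ∈ v'.asIdeal →
          x ∈ toricLocalKer (W.baseChange K) (v'.adicCompletion K) ((p ^ 1 : ℕ) : ℤ))) := by
    refine ⟨hxinf, fun v' _ ↦ ⟨fun hv'n ↦ ?_, fun q' hq' hq'v' ↦ ?_⟩⟩
    · by_cases hv'p : ((p : ℕ) : 𝓞 K) ∈ v'.asIdeal
      · rcases hall v' hv'p with rfl | rfl
        · exact hx𝔭K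
        · exact hx𝔭'K
      · exact (hxfin v' hv'p).1 hv'n
    · have hv'p : ((p : ℕ) : 𝓞 K) ∉ v'.asIdeal := fun h ↦ hadm_p q' v' h hq'v'
      exact (hxfin v' hv'p).2 q' hq' hq'v'
  have hτxall := conjAct_mem_relaxedAt W K p hK c n₀ 1 x hxall
  have h1 : ∀ v' : HeightOneSpectrum (𝓞 K), ((1 : ℕ) : 𝓞 K) ∉ v'.asIdeal := fun v' h ↦
    v'.isPrime.ne_top ((Ideal.eq_top_iff_one _).mpr (by rw [Nat.cast_one] at h; exact h))
  have hplus : x + τ x ∈ SelQP W K p c n₀ true := by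
    refine hpack true (x + τ x) ?_ (fun w ↦ add_mem (hxall.1 w) (hτxall.1 w))
      (fun w hw ↦ add_mem ((hxall.2 w (h1 w)).1 hw) ((hτxall.2 w (h1 w)).1 hw))
      (fun q' hq' w hw ↦ add_mem ((hxall.2 w (h1 w)).2 q' hq' hw) ((hτxall.2 w (h1 w)).2 q' hq' hw))
    rw [map_add, hττ, add_comm, show sgnP true = 1 from rfl, one_zsmul]
  have hminus : x - τ x ∈ SelQP W K p c n₀ false := by
    refine hpack false (x - τ x) ?_ (fun w ↦ sub_mem (hxall.1 w) (hτxall.1 w))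
      (fun w hw ↦ sub_mem ((hxall.2 w (h1 w)).1 hw) ((hτxall.2 w (h1 w)).1 hw))
      (fun q' hq' w hw ↦ sub_mem ((hxall.2 w (h1 w)).2 q' hq' hw) ((hτxall.2 w (h1 w)).2 q' hq' hw))
    rw [map_sub, hττ, show sgnP false = -1 from rfl, neg_one_zsmul, neg_sub]
  -- `2 • x` lies in the core line and is locally trivial at `𝔭'`, hence is `0`; `p` odd ⟹ `x = 0`
  have h2x : (2 : ℤ) • x ∈ SelQP W K p c n₀ μ := by
    have hsum : (x + τ x) + (x - τ x) = (2 : ℤ) • x := by rw [two_zsmul]; abel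
    rw [← hsum]
    cases μ
    · have h0 : x + τ x = 0 := by
        have h' : SelQP W K p c n₀ true = ⊥ := hμ0
        rw [h'] at hplus
        exact (Submodule.mem_bot (ZMod p)).mp hplus
      rw [h0, zero_add]
      exact hminus
    · have h0 : x - τ x = 0 := by
        have h' : SelQP W K p c n₀ false = ⊥ := hμ0
        rw [h'] at hminus
        exact (Submodule.mem_bot (ZMod p)).mp hminus
      rw [h0, add_zero]
      exact hplus
  have h2x0 : (2 : ℤ) • x = 0 := by
    by_contra hne2
    exact hvis μ _ h2x hne2 𝔭' h𝔭' (AddSubgroup.zsmul_mem _ hx𝔭' 2)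
  exact eq_zero_of_two_zsmul_of_odd_zsmul hNodd h2x0 (zsmul_discreteH1_torsion ((p ^ 1 : ℕ) : ℤ) x)

end Residual

end Summit.BirchSwinnertonDyer.BirchSwinnertonDyer.Theorems.AdditiveKoly

end
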